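import Mathlib
import Literature.NumberTheory.LFunctions.Zhang2022.Section4GaussianWeight
import Literature.Analysis.Complex.CauchyTaylorBall
import Literature.Analysis.Complex.RectangleCauchyDerivatives
import HarnessLib

/-!
# The triple pole at `s = 0` of `ζ(1+s)²·g(s)·Yˢω₁(s)/s`: pole datum and the size of its residue
# (the step "we can move the contour … to obtain `Σ_{n<T} χ(n)τ₂(n)ϖ₁ⱼ(n)/n = L′(1,χ)²𝒰₁ⱼ(1) + O(α₁)`"
# of Zhang (2022) §15 p. 87, tex L4359–L4361; also the shape of §16 (16.10), §17)

Topic `Literature/NumberTheory/LFunctions/Zhang2022` (Landau–Siegel audit tree; verdict-neutral).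
Y. Zhang, *Discrete mean estimates and the Landau–Siegel zero*, arXiv:2211.02515v1 (2022)
[Zhang2022LandauSiegel] — **an unrefereed manuscript under adjudication**. This file contains NO claim of
the manuscript and nothing about its Theorems 1–2: it is the character-free local analysis at `s = 0` of an
integrand of the shape `G(s) = ζ(1+s)²·g(s)·K(s)`, `K(s) = Yˢω₁(s)/s` (`ω₁(w) = exp{w²/(4Λ)}` of §4 (4.1),
`GaussWeight.omega1`), with `g` holomorphic near `0` — in §15 p. 87, `g(s) = L(1+s−βⱼ,χ)²·U(1+s)` and
`Y = T`; the contour bookkeeping is the tree's `GaussKernelContour.norm_lineIntegral_sub_residues_le`.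

* `pole_datum_triple` — on a neighbourhood of `0`, `G(z) = φ(z)/z³` with the holomorphic numerator
  `φ(z) = ζ₁(1+z)²·g(z)·Yᶻω₁(z)` (`ζ(s) = (s−1)⁻¹ζ₁(s)`, Mathlib `riemannZeta₁`), in the format of the
  pole hypothesis of `Literature.Analysis.Complex.rectBoundaryIntegral_eq_sum_of_poles`;
* `residue_triple_eq` — the residue `((swap dslope 0)^[2] φ) 0 = ½φ″(0)`;
* `norm_residue_triple_sub_le` — the SIZE LEMMA: writing `g = M·V` (`M`, `V` holomorphic on `ball 0 r`,
  `‖V‖ ≤ S` there, `r ≤ 1/2`), for any "main value" `m`,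
  `‖½φ″(0) − m·V(0)‖ ≤ ‖½M″(0) − m‖·S + (explicit first/second-order terms in ‖M(0)‖, ‖M′(0)‖, S/r,
  S/r², log Y)` — Leibniz (Mathlib `iteratedDeriv_mul`) for the Taylor coefficient of order two of
  `ζ₁(1+z)²ω₁(z) · Yᶻ · M · V`, the exact coefficients `1, log Y, ½log²Y` of `Yᶻ`, Cauchy's estimates
  (`Literature.Analysis.Complex.CauchyTaylorBall`) for `V` on `ball 0 r` and for `ζ₁(1+z)²ω₁(z)` on
  `ball 0 (1/2)` (`‖ζ₁(w)‖ ≤ (‖w‖+2)⁴` for `Re w ≥ −1`, re-proved here from Mathlib).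

In §15 p. 87 one takes `m = L′(1,χ)²`, `M(z) = L(1+z−βⱼ,χ)²` (so `½M″(0) − m`, `M′(0)`, `M(0)` are
`O(α·…)` by `L(1−βⱼ,χ) = −βⱼL′(1,χ) + O(α²𝓛³)`), `V(z) = U(1+z)`, `r = 1/𝓛`, `Y = T`.

## References
* Y. Zhang, arXiv:2211.02515v1 (2022), §15 p. 87, tex L4354–L4361. [cite: Zhang2022LandauSiegel, §15 p.87]
* J. B. Conway, *Functions of One Complex Variable I*, GTM 11, Ch. V Prop. 2.4 (residue at a pole of
  finite order). [cite: Conway1978, Ch. V Prop. 2.4]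
-/

noncomputable section

open Complex Real Set Filter Topology Metric

namespace Literature.NumberTheory.LFunctions.Zhang2022.U055

open GaussWeight

/-! ### Holomorphy of the factors -/

/-- `ω₁` is entire. [cite: Zhang2022LandauSiegel, §4 (4.1)] -/
theorem differentiable_omega1 (Λ : ℝ) : Differentiable ℂ (omega1 Λ) := by
  unfold omega1; fun_prop

/-- `z ↦ Yᶻ` is entire for `Y > 0`. [folklore] -/
private theorem differentiable_const_cpow_of_pos {Y : ℝ} (hY : 0 < Y) :
    Differentiable ℂ (fun z : ℂ => (Y : ℂ) ^ z) := fun z =>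
  differentiableAt_id.const_cpow (Or.inl (by exact_mod_cast hY.ne'))

/-- `z ↦ ζ₁(1+z)` is entire (Mathlib `differentiable_riemannZeta₁`). [folklore] -/
private theorem differentiable_zeta1_one_add : Differentiable ℂ (fun z : ℂ => riemannZeta₁ (1 + z)) :=
  differentiable_riemannZeta₁.comp (differentiable_const _ |>.add differentiable_id)

/-! ### The pole datum at `s = 0` -/

/-- **Pole datum of `ζ(1+z)²·g(z)·Yᶻω₁(z)/z` at `z = 0`**: if `g` is holomorphic on a neighbourhood `V`
of `0`, then on `V ∖ {0}` the integrand equals `φ(z)/(z−0)³` with the numerator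
`φ(z) = ζ₁(1+z)²·g(z)·Yᶻω₁(z)` holomorphic on `V` (`ζ(1+z) = z⁻¹ζ₁(1+z)`): the hypothesis `hpole` of the
tree's residue theorem with `n = 2`. [cite: Conway1978, Ch. V Prop. 2.4] -/
theorem pole_datum_triple {g : ℂ → ℂ} {V : Set ℂ} (hV : V ∈ 𝓝 (0 : ℂ)) (hg : DifferentiableOn ℂ g V)
    (Λ : ℝ) {Y : ℝ} (hY : 0 < Y) :
    ∃ V' ∈ 𝓝 (0 : ℂ),
      DifferentiableOn ℂ (fun z => riemannZeta₁ (1 + z) ^ 2 * g z * ((Y : ℂ) ^ z * omega1 Λ z)) V' ∧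
      ∀ z ∈ V', z ≠ 0 →
        riemannZeta (1 + z) ^ 2 * g z * ((Y : ℂ) ^ z * omega1 Λ z / z) =
          (riemannZeta₁ (1 + z) ^ 2 * g z * ((Y : ℂ) ^ z * omega1 Λ z)) / (z - 0) ^ (2 + 1) := by
  refine ⟨V, hV, ?_, fun z _ hz => ?_⟩
  · refine DifferentiableOn.mul (DifferentiableOn.mul ?_ hg) ?_
    · exact ((differentiable_zeta1_one_add).pow 2).differentiableOn
    · exact ((differentiable_const_cpow_of_pos hY).mul (differentiable_omega1 Λ)).differentiableOn
  · have h1 : (1 : ℂ) + z ≠ 1 := by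
      intro h; apply hz; linear_combination h
    rw [riemannZeta_eq_inv_sub_mul h1, show (1 : ℂ) + z - 1 = z by ring, sub_zero]
    field_simp
    ring

/-- **The residue at the triple pole is `½φ″(0)`** (`Res_{z=0} φ(z)/z³ = φ″(0)/2!`), in the `dslope`
format of the tree's residue theorem. [cite: Conway1978, Ch. V Prop. 2.4] -/
theorem residue_triple_eq {φ : ℂ → ℂ} {V : Set ℂ} (hV : V ∈ 𝓝 (0 : ℂ)) (hφ : DifferentiableOn ℂ φ V) :
    (Function.swap dslope (0 : ℂ))^[2] φ 0 = iteratedDeriv 2 φ 0 / 2 := by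
  rw [Literature.Analysis.Complex.iterate_dslope_apply_eq_iteratedDeriv_div hV hφ 2]
  norm_num [Nat.factorial]


/-! ### Bounds for the fixed factors `ζ₁(1+z)²ω₁(z)` and `Yᶻ` near `z = 0` -/

/-- `ζ₁` is bounded on the closed disc `|w − 1| ≤ 1/2` (continuity on a compact set). [folklore] -/
private theorem exists_bound_zeta1_closedBall :
    ∃ K : ℝ, 0 ≤ K ∧ ∀ w ∈ closedBall (1 : ℂ) (1 / 2), ‖riemannZeta₁ w‖ ≤ K := by
  obtain ⟨K, hK⟩ := (isCompact_closedBall (1 : ℂ) (1 / 2)).exists_bound_of_continuousOn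
    differentiable_riemannZeta₁.continuous.continuousOn
  exact ⟨max K 0, le_max_right _ _, fun w hw => (hK w hw).trans (le_max_left _ _)⟩

/-- `|ω₁(z)| ≤ 2` for `|z| < 1/2` and `Λ ≥ 1` (`|exp w| ≤ exp|w|`, `|z²/(4Λ)| ≤ 1/16`).
[cite: Zhang2022LandauSiegel, §4 (4.1)] -/
theorem norm_omega1_le_two {Λ : ℝ} (hΛ : 1 ≤ Λ) {z : ℂ} (hz : ‖z‖ < 1 / 2) : ‖omega1 Λ z‖ ≤ 2 := by
  unfold omega1
  rw [Complex.norm_exp]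
  have h1 : (z ^ 2 / ((4 * Λ : ℝ) : ℂ)).re ≤ ‖z ^ 2 / ((4 * Λ : ℝ) : ℂ)‖ := Complex.re_le_norm _
  have h2 : ‖z ^ 2 / ((4 * Λ : ℝ) : ℂ)‖ ≤ 1 / 16 := by
    rw [norm_div, norm_pow, Complex.norm_real, Real.norm_eq_abs, abs_of_pos (by linarith)]
    rw [div_le_iff₀ (by linarith)]
    have hz0 : 0 ≤ ‖z‖ := norm_nonneg _
    nlinarith
  calc rexp (z ^ 2 / ((4 * Λ : ℝ) : ℂ)).re ≤ rexp (1 / 16) := Real.exp_le_exp.mpr (h1.trans h2)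
    _ ≤ 2 := by
      have h2 := Real.log_two_gt_d9
      calc rexp (1 / 16) ≤ rexp (Real.log 2) := Real.exp_le_exp.mpr (by linarith)
        _ = 2 := Real.exp_log (by norm_num)

/-- The prefactor `P(z) = ζ₁(1+z)²ω₁(z)` is bounded by `2K_ζ²` on `|z| < 1/2` (`K_ζ` a bound for `ζ₁` on
`|w−1| ≤ 1/2`, `Λ ≥ 1`). [folklore] -/
private theorem norm_prefactor_le {K : ℝ} (hK : ∀ w ∈ closedBall (1 : ℂ) (1 / 2), ‖riemannZeta₁ w‖ ≤ K)
    {Λ : ℝ} (hΛ : 1 ≤ Λ) {z : ℂ} (hz : z ∈ ball (0 : ℂ) (1 / 2)) :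
    ‖riemannZeta₁ (1 + z) ^ 2 * omega1 Λ z‖ ≤ 2 * K ^ 2 := by
  rw [mem_ball_zero_iff] at hz
  have h1 : ‖riemannZeta₁ (1 + z)‖ ≤ K := hK _ (by
    rw [mem_closedBall, dist_eq_norm, show (1 : ℂ) + z - 1 = z by ring]; exact hz.le)
  rw [norm_mul, norm_pow]
  have h2 := norm_omega1_le_two hΛ hz
  have h3 : ‖riemannZeta₁ (1 + z)‖ ^ 2 ≤ K ^ 2 := pow_le_pow_left₀ (norm_nonneg _) h1 2
  calc ‖riemannZeta₁ (1 + z)‖ ^ 2 * ‖omega1 Λ z‖ ≤ K ^ 2 * 2 :=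
        mul_le_mul h3 h2 (norm_nonneg _) (by positivity)
    _ = 2 * K ^ 2 := by ring

/-- The prefactor is entire. [folklore] -/
private theorem differentiable_prefactor (Λ : ℝ) :
    Differentiable ℂ (fun z : ℂ => riemannZeta₁ (1 + z) ^ 2 * omega1 Λ z) :=
  (differentiable_zeta1_one_add.pow 2).mul (differentiable_omega1 Λ)

/-- Cauchy bounds for the prefactor at `0`: `‖P′(0)‖ ≤ 8K_ζ²`, `‖P″(0)‖ ≤ 64K_ζ²`. [folklore] -/
private theorem norm_deriv_prefactor_le {K : ℝ}
    (hK : ∀ w ∈ closedBall (1 : ℂ) (1 / 2), ‖riemannZeta₁ w‖ ≤ K) {Λ : ℝ} (hΛ : 1 ≤ Λ) :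
    ‖deriv (fun z : ℂ => riemannZeta₁ (1 + z) ^ 2 * omega1 Λ z) 0‖ ≤ 8 * K ^ 2 ∧
      ‖iteratedDeriv 2 (fun z : ℂ => riemannZeta₁ (1 + z) ^ 2 * omega1 Λ z) 0‖ ≤ 64 * K ^ 2 := by
  have hR : (0 : ℝ) < 1 / 2 := by norm_num
  have hd := (differentiable_prefactor Λ).differentiableOn (s := ball (0 : ℂ) (1 / 2))
  have hM : ∀ z ∈ ball (0 : ℂ) (1 / 2), ‖riemannZeta₁ (1 + z) ^ 2 * omega1 Λ z‖ ≤ 2 * K ^ 2 :=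
    fun z hz => norm_prefactor_le hK hΛ hz
  constructor
  · have h := Literature.Analysis.Complex.norm_deriv_le_of_forall_mem_ball hR hd hM
    refine h.trans (le_of_eq ?_); ring
  · have h := Literature.Analysis.Complex.norm_iteratedDeriv_two_le_of_forall_mem_ball hR hd hM
    refine h.trans (le_of_eq ?_); field_simp; ring

/-- `Yᶻ = exp(z·log Y)` for `Y > 0`. [folklore] -/
private theorem const_cpow_eq_exp {Y : ℝ} (hY : 0 < Y) :
    (fun z : ℂ => (Y : ℂ) ^ z) = fun z => cexp ((Real.log Y : ℂ) * z) := by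
  funext z
  rw [Complex.cpow_def_of_ne_zero (by exact_mod_cast hY.ne'), Complex.ofReal_log hY.le]

/-- Taylor data of `Yᶻ` at `0`: value `1`, derivative `log Y`, second derivative `log²Y`. [folklore] -/
private theorem cpow_taylor_data {Y : ℝ} (hY : 0 < Y) :
    (fun z : ℂ => (Y : ℂ) ^ z) 0 = 1 ∧ deriv (fun z : ℂ => (Y : ℂ) ^ z) 0 = (Real.log Y : ℂ) ∧
      iteratedDeriv 2 (fun z : ℂ => (Y : ℂ) ^ z) 0 = (Real.log Y : ℂ) ^ 2 := by
  rw [const_cpow_eq_exp hY]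
  refine ⟨by simp, ?_, ?_⟩
  · have h := iteratedDeriv_cexp_const_mul 1 ((Real.log Y : ℂ))
    rw [iteratedDeriv_one] at h
    rw [h]; simp
  · rw [iteratedDeriv_cexp_const_mul]; simp


/-! ### Leibniz at order two -/

/-- Leibniz' rule at order two, pointwise: `(fg)″(x) = f″(x)g(x) + 2f′(x)g′(x) + f(x)g″(x)`.
[folklore] -/
private theorem iteratedDeriv_two_mul {f g : ℂ → ℂ} {x : ℂ} (hf : ContDiffAt ℂ 2 f x)
    (hg : ContDiffAt ℂ 2 g x) :
    iteratedDeriv 2 (fun z => f z * g z) x =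
      iteratedDeriv 2 f x * g x + 2 * deriv f x * deriv g x + f x * iteratedDeriv 2 g x := by
  rw [iteratedDeriv_fun_mul hf hg]
  simp only [Finset.sum_range_succ, Finset.sum_range_zero, Nat.choose_zero_right,
    Nat.choose_one_right, Nat.choose_self, iteratedDeriv_zero, iteratedDeriv_one, Nat.cast_one,
    Nat.cast_ofNat, zero_add, Nat.sub_zero, Nat.reduceSub, show (2 : ℕ) - 2 = 0 from rfl]
  ring

/-- First derivative of a product at a point. [folklore] -/
private theorem deriv_mul_apply {f g : ℂ → ℂ} {x : ℂ} (hf : DifferentiableAt ℂ f x)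
    (hg : DifferentiableAt ℂ g x) :
    deriv (fun z => f z * g z) x = deriv f x * g x + f x * deriv g x :=
  deriv_fun_mul hf hg


/-! ### The size lemma -/

/-- Real bookkeeping for the size lemma. [folklore] -/
private theorem assembly_le {x₂ x₁ x₀ v₀ v₁ v₂ a₁ a₂ S r K L : ℝ}
    (hx₁ : 0 ≤ x₁) (hx₀ : 0 ≤ x₀) (hx₂ : 0 ≤ x₂) (ha₁ : 0 ≤ a₁) (ha₂0 : 0 ≤ a₂) (hr : 0 < r)
    (hS : 0 ≤ S)
    (hv₀ : v₀ ≤ S) (hv₁ : v₁ ≤ 2 * S / r) (hv₂ : v₂ ≤ 8 * S / r ^ 2)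
    (ha₁' : a₁ ≤ K + L) (ha₂ : a₂ ≤ 2 * K + 2 * K * L + L ^ 2) :
    x₂ * v₀ + x₁ * v₁ + x₀ * v₂ / 2 + a₁ * (x₁ * v₀ + x₀ * v₁) + a₂ / 2 * (x₀ * v₀) ≤
      x₂ * S + x₁ * (2 * S / r) + x₀ * (4 * S / r ^ 2) + (K + L) * (x₁ * S + x₀ * (2 * S / r)) +
        (K + K * L + L ^ 2 / 2) * (x₀ * S) := by
  have h1 : x₂ * v₀ ≤ x₂ * S := mul_le_mul_of_nonneg_left hv₀ hx₂
  have h2 : x₁ * v₁ ≤ x₁ * (2 * S / r) := mul_le_mul_of_nonneg_left hv₁ hx₁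
  have h3 : x₀ * v₂ / 2 ≤ x₀ * (4 * S / r ^ 2) := by
    have := mul_le_mul_of_nonneg_left hv₂ hx₀
    have e : x₀ * (8 * S / r ^ 2) / 2 = x₀ * (4 * S / r ^ 2) := by ring
    linarith
  have h4 : x₁ * v₀ + x₀ * v₁ ≤ x₁ * S + x₀ * (2 * S / r) :=
    add_le_add (mul_le_mul_of_nonneg_left hv₀ hx₁) (mul_le_mul_of_nonneg_left hv₁ hx₀)
  have h4' : 0 ≤ x₁ * S + x₀ * (2 * S / r) := by positivity
  have h5 : a₁ * (x₁ * v₀ + x₀ * v₁) ≤ (K + L) * (x₁ * S + x₀ * (2 * S / r)) :=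
    (mul_le_mul_of_nonneg_left h4 ha₁).trans (mul_le_mul_of_nonneg_right ha₁' h4')
  have h6 : a₂ / 2 * (x₀ * v₀) ≤ (K + K * L + L ^ 2 / 2) * (x₀ * S) := by
    have hx0v0 : x₀ * v₀ ≤ x₀ * S := mul_le_mul_of_nonneg_left hv₀ hx₀
    have hxS : 0 ≤ x₀ * S := by positivity
    calc a₂ / 2 * (x₀ * v₀) ≤ a₂ / 2 * (x₀ * S) := mul_le_mul_of_nonneg_left hx0v0 (by linarith)
      _ ≤ (K + K * L + L ^ 2 / 2) * (x₀ * S) := by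
        apply mul_le_mul_of_nonneg_right _ hxS; linarith
  linarith

/-- **Size of the residue at the triple pole.** There is an absolute `K ≥ 0` such that for `Λ ≥ 1`,
`Y ≥ 1`, `r > 0`, `M`, `V` holomorphic on `ball 0 r` with `‖V‖ ≤ S` there, and any `m ∈ ℂ`, the residue
`½φ″(0)` of `ζ(1+z)²M(z)V(z)Yᶻω₁(z)/z` at `z = 0` (`φ = ζ₁(1+z)²·(MV)(z)·Yᶻω₁(z)`) satisfies
`‖½φ″(0) − m·V(0)‖ ≤ ‖½M″(0) − m‖S + ‖M′(0)‖·2S/r + ‖M(0)‖·4S/r² + (K + log Y)(‖M′(0)‖S + ‖M(0)‖·2S/r)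
 + (K + K log Y + ½log²Y)‖M(0)‖S`. In §15 p. 87: `M(z) = L(1+z−βⱼ,χ)²`, `m = L′(1,χ)²`, `V(z) = U(1+z)`,
`Y = T`, `r = 1/𝓛`. [cite: Zhang2022LandauSiegel, §15 p.87] -/
theorem norm_residue_triple_sub_le :
    ∃ K : ℝ, 0 ≤ K ∧ ∀ (Λ Y r S : ℝ) (M V : ℂ → ℂ) (m : ℂ), 1 ≤ Λ → 1 ≤ Y → 0 < r →
      DifferentiableOn ℂ M (ball 0 r) → DifferentiableOn ℂ V (ball 0 r) →
      (∀ z ∈ ball (0 : ℂ) r, ‖V z‖ ≤ S) →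
      ‖iteratedDeriv 2 (fun z => riemannZeta₁ (1 + z) ^ 2 * (M z * V z) * ((Y : ℂ) ^ z * omega1 Λ z)) 0
            / 2 - m * V 0‖ ≤
        ‖iteratedDeriv 2 M 0 / 2 - m‖ * S + ‖deriv M 0‖ * (2 * S / r) + ‖M 0‖ * (4 * S / r ^ 2) +
          (K + Real.log Y) * (‖deriv M 0‖ * S + ‖M 0‖ * (2 * S / r)) +
          (K + K * Real.log Y + Real.log Y ^ 2 / 2) * (‖M 0‖ * S) := by
  obtain ⟨Kζ, hKζ0, hKζ⟩ := exists_bound_zeta1_closedBall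
  refine ⟨32 * Kζ ^ 2, by positivity, fun Λ Y r S M V m hΛ hY hr hM hV hS => ?_⟩
  have hY0 : 0 < Y := lt_of_lt_of_le zero_lt_one hY
  have hlog : 0 ≤ Real.log Y := Real.log_nonneg hY
  have hball : ball (0 : ℂ) r ∈ 𝓝 (0 : ℂ) := ball_mem_nhds 0 hr
  have hS0 : 0 ≤ S := (norm_nonneg _).trans (hS 0 (mem_ball_self hr))
  -- the four factors
  set P : ℂ → ℂ := fun z => riemannZeta₁ (1 + z) ^ 2 * omega1 Λ z with hPdef
  set E : ℂ → ℂ := fun z => (Y : ℂ) ^ z with hEdef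
  have hPd : Differentiable ℂ P := differentiable_prefactor Λ
  have hEd : Differentiable ℂ E := differentiable_const_cpow_of_pos hY0
  have hPc : ContDiffAt ℂ 2 P 0 := (hPd.analyticAt 0).contDiffAt
  have hEc : ContDiffAt ℂ 2 E 0 := (hEd.analyticAt 0).contDiffAt
  have hMa : AnalyticAt ℂ M 0 := hM.analyticAt hball
  have hVa : AnalyticAt ℂ V 0 := hV.analyticAt hball
  have hMc : ContDiffAt ℂ 2 M 0 := hMa.contDiffAt
  have hVc : ContDiffAt ℂ 2 V 0 := hVa.contDiffAt
  have hAc : ContDiffAt ℂ 2 (fun z => P z * E z) 0 := hPc.mul hEc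
  have hGc : ContDiffAt ℂ 2 (fun z => M z * V z) 0 := hMc.mul hVc
  -- rewrite the integrand numerator as `(P·E)·(M·V)`
  have hφ : (fun z => riemannZeta₁ (1 + z) ^ 2 * (M z * V z) * ((Y : ℂ) ^ z * omega1 Λ z)) =
      fun z => (P z * E z) * (M z * V z) := by
    funext z; simp only [hPdef, hEdef]; ring
  -- Leibniz
  have L1 := iteratedDeriv_two_mul hAc hGc
  have L2 := iteratedDeriv_two_mul hMc hVc
  have L3 := deriv_mul_apply hMa.differentiableAt hVa.differentiableAt
  have L4 := iteratedDeriv_two_mul hPc hEc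
  have L5 := deriv_mul_apply (hPd 0) (hEd 0)
  -- values of `P`, `E` at `0`
  have hP0 : P 0 = 1 := by simp [hPdef, omega1]
  obtain ⟨hE0, hE1, hE2⟩ := cpow_taylor_data hY0
  -- the identity
  set M₀ := M 0
  set M₁ := deriv M 0
  set M₂ := iteratedDeriv 2 M 0
  set V₀ := V 0
  set V₁ := deriv V 0
  set V₂ := iteratedDeriv 2 V 0
  set P₁ := deriv P 0
  set P₂ := iteratedDeriv 2 P 0
  set ℓ : ℂ := (Real.log Y : ℂ)
  have key : iteratedDeriv 2 (fun z => riemannZeta₁ (1 + z) ^ 2 * (M z * V z) *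
        ((Y : ℂ) ^ z * omega1 Λ z)) 0 / 2 - m * V₀ =
      (M₂ / 2 - m) * V₀ + M₁ * V₁ + M₀ * V₂ / 2 + (P₁ + ℓ) * (M₁ * V₀ + M₀ * V₁) +
        (P₂ + 2 * P₁ * ℓ + ℓ ^ 2) / 2 * (M₀ * V₀) := by
    rw [hφ, L1, L2, L3, L4, L5, hP0]
    simp only [hEdef] at hE0 hE1 hE2 ⊢
    rw [hE0, hE1, hE2]
    ring
  rw [key]
  -- bounds on the pieces
  have bV₀ : ‖V₀‖ ≤ S := hS 0 (mem_ball_self hr)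
  have bV₁ : ‖V₁‖ ≤ 2 * S / r := Literature.Analysis.Complex.norm_deriv_le_of_forall_mem_ball hr hV hS
  have bV₂ : ‖V₂‖ ≤ 8 * S / r ^ 2 :=
    Literature.Analysis.Complex.norm_iteratedDeriv_two_le_of_forall_mem_ball hr hV hS
  obtain ⟨bP₁, bP₂⟩ := norm_deriv_prefactor_le hKζ hΛ
  have hℓ : ‖ℓ‖ = Real.log Y := by
    simp only [ℓ, Complex.norm_real, Real.norm_eq_abs, abs_of_nonneg hlog]
  have ba₁ : ‖P₁ + ℓ‖ ≤ 32 * Kζ ^ 2 + Real.log Y := by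
    calc ‖P₁ + ℓ‖ ≤ ‖P₁‖ + ‖ℓ‖ := norm_add_le _ _
      _ ≤ 8 * Kζ ^ 2 + Real.log Y := by rw [hℓ]; exact add_le_add bP₁ le_rfl
      _ ≤ 32 * Kζ ^ 2 + Real.log Y := by nlinarith [sq_nonneg Kζ]
  have ba₂ : ‖P₂ + 2 * P₁ * ℓ + ℓ ^ 2‖ ≤
      2 * (32 * Kζ ^ 2) + 2 * (32 * Kζ ^ 2) * Real.log Y + Real.log Y ^ 2 := by
    calc ‖P₂ + 2 * P₁ * ℓ + ℓ ^ 2‖ ≤ ‖P₂‖ + ‖2 * P₁ * ℓ‖ + ‖ℓ ^ 2‖ := norm_add₃_le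
      _ = ‖P₂‖ + 2 * ‖P₁‖ * Real.log Y + Real.log Y ^ 2 := by
          rw [norm_mul, norm_mul, norm_pow, hℓ]; norm_num
      _ ≤ 64 * Kζ ^ 2 + 2 * (8 * Kζ ^ 2) * Real.log Y + Real.log Y ^ 2 := by gcongr
      _ ≤ _ := by nlinarith [sq_nonneg Kζ, hlog]
  -- triangle inequality and assembly
  have hn : ‖(M₂ / 2 - m) * V₀ + M₁ * V₁ + M₀ * V₂ / 2 + (P₁ + ℓ) * (M₁ * V₀ + M₀ * V₁) +
        (P₂ + 2 * P₁ * ℓ + ℓ ^ 2) / 2 * (M₀ * V₀)‖ ≤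
      ‖M₂ / 2 - m‖ * ‖V₀‖ + ‖M₁‖ * ‖V₁‖ + ‖M₀‖ * ‖V₂‖ / 2 +
        ‖P₁ + ℓ‖ * (‖M₁‖ * ‖V₀‖ + ‖M₀‖ * ‖V₁‖) +
        ‖P₂ + 2 * P₁ * ℓ + ℓ ^ 2‖ / 2 * (‖M₀‖ * ‖V₀‖) := by
    have t1 : ‖(M₂ / 2 - m) * V₀‖ = ‖M₂ / 2 - m‖ * ‖V₀‖ := norm_mul _ _
    have t2 : ‖M₁ * V₁‖ = ‖M₁‖ * ‖V₁‖ := norm_mul _ _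
    have t3 : ‖M₀ * V₂ / 2‖ = ‖M₀‖ * ‖V₂‖ / 2 := by
      rw [norm_div, norm_mul]; norm_num
    have t4 : ‖(P₁ + ℓ) * (M₁ * V₀ + M₀ * V₁)‖ ≤ ‖P₁ + ℓ‖ * (‖M₁‖ * ‖V₀‖ + ‖M₀‖ * ‖V₁‖) := by
      rw [norm_mul]
      gcongr
      calc ‖M₁ * V₀ + M₀ * V₁‖ ≤ ‖M₁ * V₀‖ + ‖M₀ * V₁‖ := norm_add_le _ _
        _ = ‖M₁‖ * ‖V₀‖ + ‖M₀‖ * ‖V₁‖ := by rw [norm_mul, norm_mul]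
    have t5 : ‖(P₂ + 2 * P₁ * ℓ + ℓ ^ 2) / 2 * (M₀ * V₀)‖ =
        ‖P₂ + 2 * P₁ * ℓ + ℓ ^ 2‖ / 2 * (‖M₀‖ * ‖V₀‖) := by
      rw [norm_mul, norm_div, norm_mul]; norm_num
    calc _ ≤ ‖(M₂ / 2 - m) * V₀‖ + ‖M₁ * V₁‖ + ‖M₀ * V₂ / 2‖ +
          ‖(P₁ + ℓ) * (M₁ * V₀ + M₀ * V₁)‖ + ‖(P₂ + 2 * P₁ * ℓ + ℓ ^ 2) / 2 * (M₀ * V₀)‖ := by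
          refine (norm_add_le _ _).trans ?_
          gcongr
          refine (norm_add_le _ _).trans ?_
          gcongr
          refine (norm_add_le _ _).trans ?_
          gcongr
          exact norm_add_le _ _
      _ ≤ _ := by rw [t1, t2, t3, t5]; gcongr
  refine hn.trans ?_
  have h := assembly_le (x₂ := ‖M₂ / 2 - m‖) (x₁ := ‖M₁‖) (x₀ := ‖M₀‖) (v₀ := ‖V₀‖) (v₁ := ‖V₁‖)
    (v₂ := ‖V₂‖) (a₁ := ‖P₁ + ℓ‖) (a₂ := ‖P₂ + 2 * P₁ * ℓ + ℓ ^ 2‖) (S := S) (r := r)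
    (K := 32 * Kζ ^ 2) (L := Real.log Y) (norm_nonneg _) (norm_nonneg _) (norm_nonneg _)
    (norm_nonneg _) (norm_nonneg _) hr hS0 bV₀ bV₁ bV₂ ba₁ ba₂
  have e : ‖P₂ + 2 * P₁ * ℓ + ℓ ^ 2‖ / 2 * (‖M₀‖ * ‖V₀‖) =
      ‖P₂ + 2 * P₁ * ℓ + ℓ ^ 2‖ / 2 * (‖M₀‖ * ‖V₀‖) := rfl
  linarith

/-! ### Appendix (ZHANG-L WP16 Block C, zl-libC-p1): decoupled radii

In §16 p. 94 (`Typed.Section16B.Step16_u041aR`) the character-side factor is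
`M(z) = ζ(1+z−βⱼ)·L(1+z,χ)·L(1+z−βⱼ,χ)²`, which is analytic at `0` but has a pole at `z = βⱼ`
(`|βⱼ| < 5α ≪ 1/𝓛`), so it is NOT holomorphic on the ball `|z| < r = 1/𝓛` on which `V(z) = E₂ⱼ(1+z)` is
bounded; the size lemma is therefore re-stated with `M` merely analytic at `0` (the proof above uses
`M` only through its 2-jet at `0`), `V` as before. -/

/-- **Size of the residue at the triple pole, decoupled radii** (same statement and constants as
`norm_residue_triple_sub_le`, with the hypothesis on `M` weakened to analyticity AT `0`; `V` holomorphic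
with `‖V‖ ≤ S` on `ball 0 r`). In §16 p. 94: `M(z) = ζ(1+z−βⱼ)L(1+z,χ)L(1+z−βⱼ,χ)²`, `m = L′(1,χ)³`,
`V(z) = E₂ⱼ(1+z)`, `Y = T`, `r = 1/𝓛`. [cite: Zhang2022LandauSiegel, §16 p.94] -/
theorem norm_residue_triple_sub_le_of_analyticAt :
    ∃ K : ℝ, 0 ≤ K ∧ ∀ (Λ Y r S : ℝ) (M V : ℂ → ℂ) (m : ℂ), 1 ≤ Λ → 1 ≤ Y → 0 < r →
      AnalyticAt ℂ M 0 → DifferentiableOn ℂ V (ball 0 r) →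
      (∀ z ∈ ball (0 : ℂ) r, ‖V z‖ ≤ S) →
      ‖iteratedDeriv 2 (fun z => riemannZeta₁ (1 + z) ^ 2 * (M z * V z) * ((Y : ℂ) ^ z * omega1 Λ z)) 0
            / 2 - m * V 0‖ ≤
        ‖iteratedDeriv 2 M 0 / 2 - m‖ * S + ‖deriv M 0‖ * (2 * S / r) + ‖M 0‖ * (4 * S / r ^ 2) +
          (K + Real.log Y) * (‖deriv M 0‖ * S + ‖M 0‖ * (2 * S / r)) +
          (K + K * Real.log Y + Real.log Y ^ 2 / 2) * (‖M 0‖ * S) := by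
  obtain ⟨Kζ, hKζ0, hKζ⟩ := exists_bound_zeta1_closedBall
  refine ⟨32 * Kζ ^ 2, by positivity, fun Λ Y r S M V m hΛ hY hr hM hV hS => ?_⟩
  have hY0 : 0 < Y := lt_of_lt_of_le zero_lt_one hY
  have hlog : 0 ≤ Real.log Y := Real.log_nonneg hY
  have hball : ball (0 : ℂ) r ∈ 𝓝 (0 : ℂ) := ball_mem_nhds 0 hr
  have hS0 : 0 ≤ S := (norm_nonneg _).trans (hS 0 (mem_ball_self hr))
  -- the four factors
  set P : ℂ → ℂ := fun z => riemannZeta₁ (1 + z) ^ 2 * omega1 Λ z with hPdef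
  set E : ℂ → ℂ := fun z => (Y : ℂ) ^ z with hEdef
  have hPd : Differentiable ℂ P := differentiable_prefactor Λ
  have hEd : Differentiable ℂ E := differentiable_const_cpow_of_pos hY0
  have hPc : ContDiffAt ℂ 2 P 0 := (hPd.analyticAt 0).contDiffAt
  have hEc : ContDiffAt ℂ 2 E 0 := (hEd.analyticAt 0).contDiffAt
  have hMa : AnalyticAt ℂ M 0 := hM
  have hVa : AnalyticAt ℂ V 0 := hV.analyticAt hball
  have hMc : ContDiffAt ℂ 2 M 0 := hMa.contDiffAt
  have hVc : ContDiffAt ℂ 2 V 0 := hVa.contDiffAt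
  have hAc : ContDiffAt ℂ 2 (fun z => P z * E z) 0 := hPc.mul hEc
  have hGc : ContDiffAt ℂ 2 (fun z => M z * V z) 0 := hMc.mul hVc
  -- rewrite the integrand numerator as `(P·E)·(M·V)`
  have hφ : (fun z => riemannZeta₁ (1 + z) ^ 2 * (M z * V z) * ((Y : ℂ) ^ z * omega1 Λ z)) =
      fun z => (P z * E z) * (M z * V z) := by
    funext z; simp only [hPdef, hEdef]; ring
  -- Leibniz
  have L1 := iteratedDeriv_two_mul hAc hGc
  have L2 := iteratedDeriv_two_mul hMc hVc
  have L3 := deriv_mul_apply hMa.differentiableAt hVa.differentiableAt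
  have L4 := iteratedDeriv_two_mul hPc hEc
  have L5 := deriv_mul_apply (hPd 0) (hEd 0)
  -- values of `P`, `E` at `0`
  have hP0 : P 0 = 1 := by simp [hPdef, omega1]
  obtain ⟨hE0, hE1, hE2⟩ := cpow_taylor_data hY0
  -- the identity
  set M₀ := M 0
  set M₁ := deriv M 0
  set M₂ := iteratedDeriv 2 M 0
  set V₀ := V 0
  set V₁ := deriv V 0
  set V₂ := iteratedDeriv 2 V 0
  set P₁ := deriv P 0
  set P₂ := iteratedDeriv 2 P 0
  set ℓ : ℂ := (Real.log Y : ℂ)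
  have key : iteratedDeriv 2 (fun z => riemannZeta₁ (1 + z) ^ 2 * (M z * V z) *
        ((Y : ℂ) ^ z * omega1 Λ z)) 0 / 2 - m * V₀ =
      (M₂ / 2 - m) * V₀ + M₁ * V₁ + M₀ * V₂ / 2 + (P₁ + ℓ) * (M₁ * V₀ + M₀ * V₁) +
        (P₂ + 2 * P₁ * ℓ + ℓ ^ 2) / 2 * (M₀ * V₀) := by
    rw [hφ, L1, L2, L3, L4, L5, hP0]
    simp only [hEdef] at hE0 hE1 hE2 ⊢
    rw [hE0, hE1, hE2]
    ring
  rw [key]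
  -- bounds on the pieces
  have bV₀ : ‖V₀‖ ≤ S := hS 0 (mem_ball_self hr)
  have bV₁ : ‖V₁‖ ≤ 2 * S / r := Literature.Analysis.Complex.norm_deriv_le_of_forall_mem_ball hr hV hS
  have bV₂ : ‖V₂‖ ≤ 8 * S / r ^ 2 :=
    Literature.Analysis.Complex.norm_iteratedDeriv_two_le_of_forall_mem_ball hr hV hS
  obtain ⟨bP₁, bP₂⟩ := norm_deriv_prefactor_le hKζ hΛ
  have hℓ : ‖ℓ‖ = Real.log Y := by
    simp only [ℓ, Complex.norm_real, Real.norm_eq_abs, abs_of_nonneg hlog]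
  have ba₁ : ‖P₁ + ℓ‖ ≤ 32 * Kζ ^ 2 + Real.log Y := by
    calc ‖P₁ + ℓ‖ ≤ ‖P₁‖ + ‖ℓ‖ := norm_add_le _ _
      _ ≤ 8 * Kζ ^ 2 + Real.log Y := by rw [hℓ]; exact add_le_add bP₁ le_rfl
      _ ≤ 32 * Kζ ^ 2 + Real.log Y := by nlinarith [sq_nonneg Kζ]
  have ba₂ : ‖P₂ + 2 * P₁ * ℓ + ℓ ^ 2‖ ≤
      2 * (32 * Kζ ^ 2) + 2 * (32 * Kζ ^ 2) * Real.log Y + Real.log Y ^ 2 := by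
    calc ‖P₂ + 2 * P₁ * ℓ + ℓ ^ 2‖ ≤ ‖P₂‖ + ‖2 * P₁ * ℓ‖ + ‖ℓ ^ 2‖ := norm_add₃_le
      _ = ‖P₂‖ + 2 * ‖P₁‖ * Real.log Y + Real.log Y ^ 2 := by
          rw [norm_mul, norm_mul, norm_pow, hℓ]; norm_num
      _ ≤ 64 * Kζ ^ 2 + 2 * (8 * Kζ ^ 2) * Real.log Y + Real.log Y ^ 2 := by gcongr
      _ ≤ _ := by nlinarith [sq_nonneg Kζ, hlog]
  -- triangle inequality and assembly
  have hn : ‖(M₂ / 2 - m) * V₀ + M₁ * V₁ + M₀ * V₂ / 2 + (P₁ + ℓ) * (M₁ * V₀ + M₀ * V₁) +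
        (P₂ + 2 * P₁ * ℓ + ℓ ^ 2) / 2 * (M₀ * V₀)‖ ≤
      ‖M₂ / 2 - m‖ * ‖V₀‖ + ‖M₁‖ * ‖V₁‖ + ‖M₀‖ * ‖V₂‖ / 2 +
        ‖P₁ + ℓ‖ * (‖M₁‖ * ‖V₀‖ + ‖M₀‖ * ‖V₁‖) +
        ‖P₂ + 2 * P₁ * ℓ + ℓ ^ 2‖ / 2 * (‖M₀‖ * ‖V₀‖) := by
    have t1 : ‖(M₂ / 2 - m) * V₀‖ = ‖M₂ / 2 - m‖ * ‖V₀‖ := norm_mul _ _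
    have t2 : ‖M₁ * V₁‖ = ‖M₁‖ * ‖V₁‖ := norm_mul _ _
    have t3 : ‖M₀ * V₂ / 2‖ = ‖M₀‖ * ‖V₂‖ / 2 := by
      rw [norm_div, norm_mul]; norm_num
    have t4 : ‖(P₁ + ℓ) * (M₁ * V₀ + M₀ * V₁)‖ ≤ ‖P₁ + ℓ‖ * (‖M₁‖ * ‖V₀‖ + ‖M₀‖ * ‖V₁‖) := by
      rw [norm_mul]
      gcongr
      calc ‖M₁ * V₀ + M₀ * V₁‖ ≤ ‖M₁ * V₀‖ + ‖M₀ * V₁‖ := norm_add_le _ _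
        _ = ‖M₁‖ * ‖V₀‖ + ‖M₀‖ * ‖V₁‖ := by rw [norm_mul, norm_mul]
    have t5 : ‖(P₂ + 2 * P₁ * ℓ + ℓ ^ 2) / 2 * (M₀ * V₀)‖ =
        ‖P₂ + 2 * P₁ * ℓ + ℓ ^ 2‖ / 2 * (‖M₀‖ * ‖V₀‖) := by
      rw [norm_mul, norm_div, norm_mul]; norm_num
    calc _ ≤ ‖(M₂ / 2 - m) * V₀‖ + ‖M₁ * V₁‖ + ‖M₀ * V₂ / 2‖ +
          ‖(P₁ + ℓ) * (M₁ * V₀ + M₀ * V₁)‖ + ‖(P₂ + 2 * P₁ * ℓ + ℓ ^ 2) / 2 * (M₀ * V₀)‖ := by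
          refine (norm_add_le _ _).trans ?_
          gcongr
          refine (norm_add_le _ _).trans ?_
          gcongr
          refine (norm_add_le _ _).trans ?_
          gcongr
          exact norm_add_le _ _
      _ ≤ _ := by rw [t1, t2, t3, t5]; gcongr
  refine hn.trans ?_
  have h := assembly_le (x₂ := ‖M₂ / 2 - m‖) (x₁ := ‖M₁‖) (x₀ := ‖M₀‖) (v₀ := ‖V₀‖) (v₁ := ‖V₁‖)
    (v₂ := ‖V₂‖) (a₁ := ‖P₁ + ℓ‖) (a₂ := ‖P₂ + 2 * P₁ * ℓ + ℓ ^ 2‖) (S := S) (r := r)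
    (K := 32 * Kζ ^ 2) (L := Real.log Y) (norm_nonneg _) (norm_nonneg _) (norm_nonneg _)
    (norm_nonneg _) (norm_nonneg _) hr hS0 bV₀ bV₁ bV₂ ba₁ ba₂
  have e : ‖P₂ + 2 * P₁ * ℓ + ℓ ^ 2‖ / 2 * (‖M₀‖ * ‖V₀‖) =
      ‖P₂ + 2 * P₁ * ℓ + ℓ ^ 2‖ / 2 * (‖M₀‖ * ‖V₀‖) := rfl
  linarith

end Literature.NumberTheory.LFunctions.Zhang2022.U055
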